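import Summits.AtomisticToContinuum.FouriersLaw.Theorems.OddSectorIrreversibilityCorrectorTheory
import Summits.AtomisticToContinuum.FouriersLaw.Theorems.OddSectorIrreversibilityWitnessGlueKernels

/-!
# `TapLeakBound` (stmt-AtomisticToContinuum-15159), line `Sketch`, stub `stub_correctorSmooth`

Helper file for crux `Summit.AtomisticToContinuum.FouriersLaw.Theses.OddSectorIrreversibility.TapLeakBound`
(route `OddSectorIrreversibility`, sub-problem `FouriersLaw`), skeleton line `Sketch`.

The hypotheses of P hand over the Kubo corrector `u` only as a CONTINUOUS function which is the
`μ_T`-a.e. limit (`μ_T = gibbsWeight ω₂ lam β γ N T = e^{-H/T} dq dp`, unnormalised) of the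
finite-horizon correctors `u_τ(x) = ∫_{(0,τ]} P_tJ(x) dt` (`J = ∑_k j_k` the total current, `P_t` the
equilibrium kernels). The Gibbs-calculus glue of the line needs `u ∈ C^∞` with the classical
Poisson equation `L_{T,T} u = -J`.

`stub_correctorSmooth` — IDENTIFICATION: for `N ≥ 1`, `corrector_exists` says the finite-horizon
correctors converge EVERYWHERE to `u⋆ = ∫_{(0,∞)} P_tJ dt`, and `corrector_smooth` says `u⋆` agrees
Lebesgue-a.e. with a smooth classical solution `ũ` of `L ũ = -J`. By uniqueness of limits `u = u⋆`
`μ_T`-a.e., hence Lebesgue-a.e. (the density `e^{-H/T}` never vanishes), so `u = ũ` Lebesgue-a.e.;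
two continuous functions agreeing Lebesgue-a.e. on phase space agree everywhere. For `N = 0` phase
space is a point, `u` is constant and `J = 0 = L u`.

References: Kundu–Dhar–Narayan 2009 (the corrector); Cuneo–Eckmann–Hairer–Rey-Bellet 2018,
Thm 2.13; folklore. Nothing here closes the item.
-/

noncomputable section

open MeasureTheory ProbabilityTheory Filter Topology Set Function
open scoped NNReal ENNReal ContDiff

namespace Summit.AtomisticToContinuum.FouriersLaw.Theorems.OddSectorIrreversibility.TapLeak

open Literature.MathematicalPhysics.KineticTheory.HeatConduction
open Literature.MathematicalPhysics.KineticTheory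
open Summit.AtomisticToContinuum.FouriersLaw.Theorems.OddSectorWitness
open Summit.AtomisticToContinuum.FouriersLaw.Theorems.OddSectorIrreversibility.Corrector

/-- A `gibbsWeight`-a.e. property holds Lebesgue-a.e.: the density `e^{-H/T}` of the Gibbs weight
never vanishes. [folklore] -/
theorem ae_volume_of_ae_gibbsWeight {ω₂ lam β γ T : ℝ} {N : ℕ} {p : PhaseSpace N → Prop}
    (h : ∀ᵐ x ∂(gibbsWeight ω₂ lam β γ N T), p x) :
    ∀ᵐ x ∂(volume : Measure (PhaseSpace N)), p x := by
  unfold gibbsWeight at h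
  rw [ae_withDensity_iff (measurable_gibbsDensity_ofReal γ N T)] at h
  filter_upwards [h] with x hx
  exact hx (ENNReal.ofReal_pos.2 (Real.exp_pos _)).ne'

/-- Two continuous functions on phase space that agree `gibbsWeight`-a.e. are equal. [folklore] -/
theorem eq_of_ae_eq_gibbsWeight {ω₂ lam β γ T : ℝ} {N : ℕ} {f g : PhaseSpace N → ℝ}
    (hf : Continuous f) (hg : Continuous g) (h : f =ᵐ[gibbsWeight ω₂ lam β γ N T] g) : f = g := by
  haveI := isAddHaarMeasure_volume_phaseSpace N
  exact (hf.ae_eq_iff_eq volume hg).1 (ae_volume_of_ae_gibbsWeight h)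

/-- **Identification of the Kubo corrector** (fixed `N`). A continuous `μ_T`-a.e. limit `u` of the
finite-horizon Kubo correctors `∫_{(0,τ]} P_tJ dt` is `C^∞` and solves `L_{T,T} u = -J` pointwise
(`corrector_exists`: the finite-horizon correctors converge EVERYWHERE to `u⋆`; `corrector_smooth`:
`u⋆` agrees Lebesgue-a.e. with a smooth classical solution; two continuous functions that agree
`μ_T`-a.e. agree everywhere since `e^{-H/T} > 0`; `N = 0`: `u` is constant on a one-point space and
`J = 0`). [folklore] -/
theorem stub_correctorSmooth : ∀ {ω₂ lam β γ T : ℝ}, 0 < ω₂ → 0 < lam → 0 < β → 0 < γ → 0 < T →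
    ∀ {N : ℕ} {u : PhaseSpace N → ℝ}, Continuous u →
    (∀ᵐ x ∂(gibbsWeight ω₂ lam β γ N T), Tendsto (fun τ : ℝ => ∫ t in Set.Ioc (0 : ℝ) τ,
        (∫ y, (∑ k : Fin N, (pinnedChain ω₂ lam β γ).bondCurrent N k y)
          ∂((pinnedChain ω₂ lam β γ).transitionKernel N T T t.toNNReal x))) atTop (𝓝 (u x))) →
    ContDiff ℝ ∞ u ∧
      ∀ x, (pinnedChain ω₂ lam β γ).generator N T T u x =
        -(∑ k : Fin N, (pinnedChain ω₂ lam β γ).bondCurrent N k x) := by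
  intro ω₂ lam β γ T hω hl hβ hγ hT N u huc hlim
  rcases Nat.eq_zero_or_pos N with hN0 | hN
  · -- `N = 0`: phase space is a point, `u` is constant, `J = 0`
    subst hN0
    have hu : u = fun _ => u 0 := funext fun x => congrArg u (Subsingleton.elim x 0)
    refine ⟨by rw [hu]; exact contDiff_const, fun x => ?_⟩
    rw [hu]
    simp
  · -- `N ≥ 1`: identification with the smooth corrector of the tree
    obtain ⟨v, hvs, hae, hpde, -⟩ := corrector_smooth hω hl hβ hγ hT hN
    have hϑ : 0 < 1 / (4 * T) := by positivity
    have h2ϑ : 2 * (1 / (4 * T)) < 1 / T := by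
      rw [show 2 * (1 / (4 * T)) = 1 / (2 * T) by field_simp; ring,
        div_lt_div_iff₀ (by positivity) hT]
      nlinarith
    obtain ⟨_, _, -, -, -, -, -, -, hpt, -⟩ := corrector_exists hω hl hβ hγ hT hN hϑ h2ϑ
      (fun s z => ∫ y, (∑ k : Fin N, (pinnedChain ω₂ lam β γ).bondCurrent N k y)
        ∂((pinnedChain ω₂ lam β γ).transitionKernel N T T s.toNNReal z)) rfl
      (fun z => ∫ s in Set.Ioi (0 : ℝ), ∫ y, (∑ k : Fin N, (pinnedChain ω₂ lam β γ).bondCurrent N k y)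
        ∂((pinnedChain ω₂ lam β γ).transitionKernel N T T s.toNNReal z)) rfl
    -- `u = u⋆` `μ_T`-a.e. by uniqueness of limits, `u⋆ = v` Lebesgue-a.e.
    have huw : ∀ᵐ x ∂(gibbsWeight ω₂ lam β γ N T),
        u x = ∫ s in Set.Ioi (0 : ℝ), ∫ y, (∑ k : Fin N, (pinnedChain ω₂ lam β γ).bondCurrent N k y)
          ∂((pinnedChain ω₂ lam β γ).transitionKernel N T T s.toNNReal x) := by
      filter_upwards [hlim] with x hx
      exact tendsto_nhds_unique hx (hpt x)
    have huv : u =ᵐ[gibbsWeight ω₂ lam β γ N T] v :=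
      (show u =ᵐ[gibbsWeight ω₂ lam β γ N T] _ from huw).trans
        ((withDensity_absolutelyContinuous _ _).ae_eq hae)
    have h := eq_of_ae_eq_gibbsWeight huc hvs.continuous huv
    subst h
    exact ⟨hvs, hpde⟩

end Summit.AtomisticToContinuum.FouriersLaw.Theorems.OddSectorIrreversibility.TapLeak

end
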